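import Mathlib
import HarnessLib
import Summits.Ventures.LatticeQCDFlow.Scoring.SelfNormalisedReweightingCeilingFree
import Summits.Ventures.LatticeQCDFlow.Scoring.BlockMeanHeavyTail

/-!
# The observable column with NO second weight moment: the median over `R` blocks of the printed
# self-normalised estimate `Σ_j w̃_j O_j / Σ_j w̃_j` certifies `E_p O` at exponential confidence as
# soon as `E_q w^{1+ε} = ∫ p^{1+ε}/q^ε dμ < ∞` for some `0 < ε ≤ 1` — even when `ESS = 0`

HONEST FRAMING: exact (Metropolis-corrected) sampling algorithms for lattice gauge theory;
figures of merit are autocorrelation/cost numbers at stated couplings and volumes; no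
continuum-physics claim.

Venture `LatticeQCDFlow` (cell pub-lqcd), topic `Scoring`; FANOUT row 4 (`s0-u1-b`, rung S0-B).
Row 4's ceiling-free certificate for the printed self-normalised reweighting estimate
(`Scoring/SelfNormalisedReweightingCeilingFree`) is driven by `M₂ = E_q w² = 1/ESS`: Chebyshev for
the block estimate and for the block mean weight.  With the `(1 + ε)`-th-moment truncation bound
of `Scoring/BlockMeanHeavyTail` both Chebyshev steps can be replaced, and NO second weight moment
is needed: for a bounded observable `|O| ≤ B` the shifted score `w·(O + B) ≥ 0` has `(1 + ε)`-th
moment `≤ (2B)^{1+ε}·A₁` and the weight `w ≥ 0` has `(1 + ε)`-th moment `A₁ = E_q w^{1+ε}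
= ∫ p^{1+ε}/q^ε dμ` (finite iff the Rényi divergence of order `1 + ε` of `p` from `q` is finite);
the printed ratio is shift-equivariant (`Â'/W̄ − (E_p O + B) = Â/W̄ − E_p O` with
`Â' = Â + B·W̄`), so the ratio step of `Scoring/RatioEstimatorConfidence` with `|E_p O + B| ≤ 2B`
and row 4's median device (`BlockMedian.measureReal_half_far_le`) give the certificate.  Together
with the earlier files this is the MOMENT LADDER of the ceiling-free card: acceptance column — no
weight moment beyond `∫ p = 1` (`Scoring/AllPairsAcceptanceRatioCeilingFree` needs `M₂` only
through the mean-weight step, replaced here the same way); observable column — `E_q w^{1+ε} < ∞`;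
ESS column — `E_q w^{2+2ε} < ∞` (`Scoring/KishESSHeavyTail`).  NEW WORK of the cell
(elementary); no definition; nothing cited as a fact; the median-of-means literature
(Nemirovsky–Yudin 1983; Bubeck–Cesa-Bianchi–Lugosi 2013; Lugosi–Mendelson 2019) is NAMED ONLY.

## Content (`ν = μ.withDensity q`; `w = p/q`; `A₁ = ∫ p^{1+ε}/q^ε dμ`; `|O| ≤ B`;
## `S_r = Σ_j w̃_j O_j / Σ_j w̃_j` the printed estimate of block `r`)

* §1 `weight_rpow_mul_model` (`(p/q)^{1+ε}·q = p^{1+ε}/q^ε`), `integrable_weight_rpow_model`,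
  `integral_weight_rpow_model` (`E_ν w^{1+ε} = A₁`), `shiftedScore_rpow_le`
  (`(w(O + B))^{1+ε} ≤ (2B)^{1+ε} w^{1+ε}`), `integrable_shiftedScore_rpow` (integrable, with
  `∫ (w(O + B))^{1+ε} dν ≤ (2B)^{1+ε}A₁`).
* §2 **`meanWeight_heavyTail_iid`** (`P(u ≤ |W̄ − 1|) ≤ 5A₁/(m^ε u^{1+ε})`) and
  **`shiftedEstimate_heavyTail_iid`** (`P(t ≤ |Â' − (E_p O + B)|) ≤ 5(2B)^{1+ε}A₁/(m^ε t^{1+ε})`).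
* §3 **`selfNormReweighting_medianOfBlocks_confidence_heavyTail`** — blocks of `m ≥ 1`, `R·m ≤ n`,
  `t > 0`, `0 < u < 1`, `40(2B)^{1+ε}A₁ ≤ m^ε t^{1+ε}`, `40A₁ ≤ m^ε u^{1+ε}`:
  `P(#{r < R : (t + 2Bu)/(1 − u) ≤ |S_r − ∫ p·O dμ|} ≥ R/2) ≤ exp(−R/8)`;
  `selfNormReweighting_sampleMedian_confidence_heavyTail` (ANY sample-median selection).

NOT CLAIMED: unbounded observables at this moment level; estimating `A₁` (an input); `ε = 0`; the
chain-side column; optimal constants; any number of ours re-scored.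
-/

noncomputable section

namespace Summit.Ventures.LatticeQCDFlow.Scoring.ReweightingMedian

open MeasureTheory ProbabilityTheory Finset Real Set
open Summit.Ventures.LatticeQCDFlow.Scoring.BlockMedian
open Summit.Ventures.LatticeQCDFlow.Scoring.AllPairsMedian
open Summit.Ventures.LatticeQCDFlow.Scoring.HeavyTailMedian

/-! ## §1 The weight and the shifted score at the `(1 + ε)`-th moment -/

section Model

variable {X : Type*} [MeasurableSpace X] {μ : Measure X} {p q O : X → ℝ} {ε : ℝ}

omit [MeasurableSpace X] in
/-- `(p/q)^{1+ε}·q = p^{1+ε}/q^ε` pointwise (`p ≥ 0`, `q > 0`). [ours] -/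
theorem weight_rpow_mul_model (hp0 : ∀ z, 0 ≤ p z) (hq0 : ∀ z, 0 < q z) (a : X) :
    (p a / q a) ^ (1 + ε) * q a = p a ^ (1 + ε) / q a ^ ε := by
  have hqa := hq0 a
  have e2 : q a ^ (1 + ε) = q a ^ ε * q a := by
    rw [add_comm, Real.rpow_add hqa, Real.rpow_one]
  rw [Real.div_rpow (hp0 a) hqa.le, e2]
  have hq1 : 0 < q a ^ ε := Real.rpow_pos_of_pos hqa _
  field_simp

/-- **`w^{1+ε} ∈ L¹(q dμ)` from `p^{1+ε}/q^ε ∈ L¹(μ)`.** [ours] -/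
theorem integrable_weight_rpow_model (hp0 : ∀ z, 0 ≤ p z) (hq0 : ∀ z, 0 < q z)
    (hqm : Measurable q) (hA1i : Integrable (fun z => p z ^ (1 + ε) / q z ^ ε) μ) :
    Integrable (fun a => (p a / q a) ^ (1 + ε)) (μ.withDensity fun z => ENNReal.ofReal (q z)) := by
  rw [AllPairsVariance.integrable_withDensity_iff' (fun z => (hq0 z).le) hqm]
  have h : (fun a => (p a / q a) ^ (1 + ε) * q a) = fun a => p a ^ (1 + ε) / q a ^ ε :=
    funext fun a => weight_rpow_mul_model hp0 hq0 a
  rw [h]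
  exact hA1i

/-- `E_ν w^{1+ε} = ∫ p^{1+ε}/q^ε dμ = A₁`. [ours] -/
theorem integral_weight_rpow_model (hp0 : ∀ z, 0 ≤ p z) (hq0 : ∀ z, 0 < q z)
    (hqm : Measurable q) :
    ∫ a, (p a / q a) ^ (1 + ε) ∂(μ.withDensity fun z => ENNReal.ofReal (q z))
      = ∫ z, p z ^ (1 + ε) / q z ^ ε ∂μ := by
  rw [AllPairsVariance.integral_withDensity_eq' (fun z => (hq0 z).le) hqm]
  exact integral_congr_ae (Filter.Eventually.of_forall fun a => weight_rpow_mul_model hp0 hq0 a)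

omit [MeasurableSpace X] in
/-- **The shifted score** `w·(O + B)` is non-negative and `(w(O + B))^{1+ε} ≤ (2B)^{1+ε}·w^{1+ε}`
(`p ≥ 0`, `q > 0`, `|O| ≤ B`, `ε ≥ -1` not needed: any real exponent with non-negative bases).
[ours] -/
theorem shiftedScore_rpow_le (hp0 : ∀ z, 0 ≤ p z) (hq0 : ∀ z, 0 < q z) {B : ℝ}
    (hOB : ∀ z, |O z| ≤ B) (hε : 0 ≤ 1 + ε) (a : X) :
    0 ≤ p a / q a * (O a + B)
      ∧ (p a / q a * (O a + B)) ^ (1 + ε) ≤ (2 * B) ^ (1 + ε) * (p a / q a) ^ (1 + ε) := by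
  have hw0 : 0 ≤ p a / q a := div_nonneg (hp0 a) (hq0 a).le
  have hOa := abs_le.1 (hOB a)
  have hO0 : 0 ≤ O a + B := by linarith [hOa.1]
  have hO2 : O a + B ≤ 2 * B := by linarith [hOa.2]
  refine ⟨mul_nonneg hw0 hO0, ?_⟩
  rw [Real.mul_rpow hw0 hO0, mul_comm]
  exact mul_le_mul_of_nonneg_right (Real.rpow_le_rpow hO0 hO2 hε) (Real.rpow_nonneg hw0 _)

/-- `(w(O + B))^{1+ε} ∈ L¹(q dμ)` with `∫ (w(O + B))^{1+ε} d(q dμ) ≤ (2B)^{1+ε}·A₁`. [ours] -/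
theorem integrable_shiftedScore_rpow (hp0 : ∀ z, 0 ≤ p z) (hpm : Measurable p)
    (hq0 : ∀ z, 0 < q z) (hqm : Measurable q) (hOm : Measurable O) {B : ℝ}
    (hOB : ∀ z, |O z| ≤ B) (hε : 0 ≤ 1 + ε)
    (hA1i : Integrable (fun z => p z ^ (1 + ε) / q z ^ ε) μ) :
    Integrable (fun a => (p a / q a * (O a + B)) ^ (1 + ε))
        (μ.withDensity fun z => ENNReal.ofReal (q z))
      ∧ ∫ a, (p a / q a * (O a + B)) ^ (1 + ε) ∂(μ.withDensity fun z => ENNReal.ofReal (q z))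
        ≤ (2 * B) ^ (1 + ε) * ∫ z, p z ^ (1 + ε) / q z ^ ε ∂μ := by
  have hwi := integrable_weight_rpow_model hp0 hq0 hqm hA1i
  have hint : Integrable (fun a => (p a / q a * (O a + B)) ^ (1 + ε))
      (μ.withDensity fun z => ENNReal.ofReal (q z)) := by
    refine Integrable.mono' (hwi.const_mul ((2 * B) ^ (1 + ε)))
      ((((hpm.div hqm).mul (hOm.add_const B)).pow_const (1 + ε)).aestronglyMeasurable)
      (Filter.Eventually.of_forall fun a => ?_)
    obtain ⟨h0, hle⟩ := shiftedScore_rpow_le hp0 hq0 hOB hε a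
    rw [Real.norm_eq_abs, abs_of_nonneg (Real.rpow_nonneg h0 _)]
    exact hle
  refine ⟨hint, ?_⟩
  rw [← integral_weight_rpow_model hp0 hq0 hqm, ← integral_const_mul]
  exact integral_mono hint (hwi.const_mul _) fun a => (shiftedScore_rpow_le hp0 hq0 hOB hε a).2

end Model

/-! ## §2 Per-block tails under a `(1 + ε)`-th weight moment -/

section Block

variable {Ω : Type*} [MeasurableSpace Ω] {P : Measure Ω} [IsProbabilityMeasure P]
variable {X : Type*} [MeasurableSpace X] {μ : Measure X} {p q O : X → ℝ} {ε : ℝ} {m : ℕ}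

/-- **THE MEAN WEIGHT OF `m` INDEPENDENT MODEL DRAWS UNDER A `(1 + ε)`-TH WEIGHT MOMENT**:
`P(u ≤ |W̄ − 1|) ≤ 5A₁/(m^ε u^{1+ε})` (`∫ p = 1`, `0 < ε ≤ 1`, `u > 0`); no `M₂`. [ours] -/
theorem meanWeight_heavyTail_iid {x : Fin m → Ω → X} (hxm : ∀ j, Measurable (x j))
    (hind : iIndepFun x P) (hp0 : ∀ z, 0 ≤ p z) (hpm : Measurable p) (hpi : Integrable p μ)
    (hp1 : ∫ z, p z ∂μ = 1) (hq0 : ∀ z, 0 < q z) (hqm : Measurable q) (hε0 : 0 < ε)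
    (hε1 : ε ≤ 1) (hA1i : Integrable (fun z => p z ^ (1 + ε) / q z ^ ε) μ)
    (hlaw : ∀ j, Measure.map (x j) P = μ.withDensity fun z => ENNReal.ofReal (q z))
    (hm : 1 ≤ m) {u : ℝ} (hu : 0 < u) :
    P.real {ω | u ≤ |(∑ j : Fin m, p (x j ω) / q (x j ω)) / m - 1|}
      ≤ 5 * (∫ z, p z ^ (1 + ε) / q z ^ ε ∂μ) / ((m : ℝ) ^ ε * u ^ (1 + ε)) := by
  have h := blockMean_heavyTail_iid (ν := μ.withDensity fun z => ENNReal.ofReal (q z))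
    hxm hind hlaw (g := fun a => p a / q a) (hpm.div hqm)
    (fun a => div_nonneg (hp0 a) (hq0 a).le) hε0 hε1
    (integrable_weight_rpow_model hp0 hq0 hqm hA1i) hm hu
  rw [(AllPairsVariance.integral_weight_withDensity_eq hpi hq0 hqm).2, hp1,
    integral_weight_rpow_model hp0 hq0 hqm] at h
  exact h

/-- **THE SHIFTED BLOCK ESTIMATE UNDER A `(1 + ε)`-TH WEIGHT MOMENT**: with
`Â' = Σ_j w(x_j)(O(x_j) + B)/m`, `P(t ≤ |Â' − (∫ p·O dμ + B)|) ≤ 5(2B)^{1+ε}A₁/(m^ε t^{1+ε})`.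
[ours] -/
theorem shiftedEstimate_heavyTail_iid {x : Fin m → Ω → X} (hxm : ∀ j, Measurable (x j))
    (hind : iIndepFun x P) (hp0 : ∀ z, 0 ≤ p z) (hpm : Measurable p) (hpi : Integrable p μ)
    (hp1 : ∫ z, p z ∂μ = 1) (hq0 : ∀ z, 0 < q z) (hqm : Measurable q) (hε0 : 0 < ε)
    (hε1 : ε ≤ 1) (hA1i : Integrable (fun z => p z ^ (1 + ε) / q z ^ ε) μ)
    (hOm : Measurable O) {B : ℝ} (hOB : ∀ z, |O z| ≤ B) (hOi : Integrable (fun z => p z * O z) μ)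
    (hlaw : ∀ j, Measure.map (x j) P = μ.withDensity fun z => ENNReal.ofReal (q z))
    (hm : 1 ≤ m) {t : ℝ} (ht : 0 < t) :
    P.real {ω | t ≤ |(∑ j : Fin m, p (x j ω) / q (x j ω) * (O (x j ω) + B)) / m
        - (∫ z, p z * O z ∂μ + B)|}
      ≤ 5 * ((2 * B) ^ (1 + ε) * ∫ z, p z ^ (1 + ε) / q z ^ ε ∂μ)
          / ((m : ℝ) ^ ε * t ^ (1 + ε)) := by
  have hm0 : (0 : ℝ) < m := by exact_mod_cast hm
  have hD : 0 < (m : ℝ) ^ ε * t ^ (1 + ε) :=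
    mul_pos (Real.rpow_pos_of_pos hm0 _) (Real.rpow_pos_of_pos ht _)
  have hε' : (0 : ℝ) ≤ 1 + ε := by linarith
  obtain ⟨hgi, hgle⟩ := integrable_shiftedScore_rpow (μ := μ) hp0 hpm hq0 hqm hOm hOB hε' hA1i
  have h := blockMean_heavyTail_iid (ν := μ.withDensity fun z => ENNReal.ofReal (q z))
    hxm hind hlaw (g := fun a => p a / q a * (O a + B)) ((hpm.div hqm).mul (hOm.add_const B))
    (fun a => (shiftedScore_rpow_le hp0 hq0 hOB hε' a).1) hε0 hε1 hgi hm ht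
  have hmean : ∫ a, p a / q a * (O a + B) ∂(μ.withDensity fun z => ENNReal.ofReal (q z))
      = ∫ z, p z * O z ∂μ + B := by
    rw [integral_weightMul_model hq0 hqm]
    simp_rw [mul_add]
    rw [integral_add hOi (hpi.mul_const B), integral_mul_const, hp1, one_mul]
  rw [hmean] at h
  exact h.trans (div_le_div_of_nonneg_right (by linarith) hD.le)

end Block

/-! ## §3 The certificate -/

section Certificate

variable {Ω : Type*} [MeasurableSpace Ω] {P : Measure Ω} [IsProbabilityMeasure P]
variable {X : Type*} [MeasurableSpace X] {μ : Measure X} {p q O : X → ℝ} {ε : ℝ} {n m R : ℕ}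

/-- **THE PRINTED SELF-NORMALISED ESTIMATE WITH NO SECOND WEIGHT MOMENT.**  `n` independent model
draws `y_j` (laws `μ.withDensity q`); `p ≥ 0` measurable, integrable, `∫ p = 1`, with
`p^{1+ε}/q^ε ∈ L¹(μ)` (`A₁ = E_q w^{1+ε}`) for some `0 < ε ≤ 1`; `q > 0` measurable; `O` measurable,
`|O| ≤ B`; weights printed with ANY normalisation `w̃ = c·p/q`, `c > 0`; blocks of `m ≥ 1` draws,
`R·m ≤ n`; `t > 0`, `0 < u < 1` with `40(2B)^{1+ε}A₁ ≤ m^ε t^{1+ε}` and `40A₁ ≤ m^ε u^{1+ε}`.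
With `S_r = Σ_j w̃_j O_j / Σ_j w̃_j`:
`P( #{r < R : (t + 2Bu)/(1 − u) ≤ |S_r − ∫ p·O dμ|} ≥ R/2 ) ≤ exp(−R/8)`. [ours] -/
theorem selfNormReweighting_medianOfBlocks_confidence_heavyTail {y : Fin n → Ω → X}
    (hym : ∀ j, Measurable (y j)) (hind : iIndepFun y P) (hp0 : ∀ z, 0 ≤ p z)
    (hpm : Measurable p) (hpi : Integrable p μ) (hp1 : ∫ z, p z ∂μ = 1) (hq0 : ∀ z, 0 < q z)
    (hqm : Measurable q) (hε0 : 0 < ε) (hε1 : ε ≤ 1)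
    (hA1i : Integrable (fun z => p z ^ (1 + ε) / q z ^ ε) μ) (hOm : Measurable O) {B : ℝ}
    (hOB : ∀ z, |O z| ≤ B)
    (hlaw : ∀ j, Measure.map (y j) P = μ.withDensity fun z => ENNReal.ofReal (q z))
    {wt : X → ℝ} {c : ℝ} (hc : 0 < c) (hwt : ∀ z, wt z = c * (p z / q z))
    (hm : 1 ≤ m) (hRm : R * m ≤ n) {t u : ℝ} (ht : 0 < t) (hu : 0 < u) (hu1 : u < 1)
    (hvt : 40 * ((2 * B) ^ (1 + ε) * ∫ z, p z ^ (1 + ε) / q z ^ ε ∂μ)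
      ≤ (m : ℝ) ^ ε * t ^ (1 + ε))
    (hvu : 40 * ∫ z, p z ^ (1 + ε) / q z ^ ε ∂μ ≤ (m : ℝ) ^ ε * u ^ (1 + ε)) :
    P.real {ω | (R : ℝ) / 2 ≤ #{r ∈ (univ : Finset (Fin R)) | (t + 2 * B * u) / (1 - u) ≤
        |(∑ j : Fin m, wt (y ⟨((r : Fin R) : ℕ) * m + j, mul_add_lt hRm r j⟩ ω)
              * O (y ⟨((r : Fin R) : ℕ) * m + j, mul_add_lt hRm r j⟩ ω))
            / (∑ j : Fin m, wt (y ⟨((r : Fin R) : ℕ) * m + j, mul_add_lt hRm r j⟩ ω))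
          - ∫ z, p z * O z ∂μ|}} ≤ exp (-(R / 8)) := by
  rcases Nat.eq_zero_or_pos R with hR | hR
  · subst hR
    refine measureReal_le_one.trans ?_
    simp
  have ha : |∫ z, p z * O z ∂μ| ≤ B := abs_integral_targetMul_le hp0 hpi hp1 hOB
  have hB0 : 0 ≤ B := (abs_nonneg _).trans ha
  have hOi : Integrable (fun z => p z * O z) μ := by
    refine Integrable.mono' (hpi.mul_const B) (hpm.mul hOm).aestronglyMeasurable
      (Filter.Eventually.of_forall fun z => ?_)
    rw [Real.norm_eq_abs, abs_mul, abs_of_nonneg (hp0 z)]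
    exact mul_le_mul_of_nonneg_left (hOB z) (hp0 z)
  have hwtm : Measurable wt := by
    have : wt = fun z => c * (p z / q z) := funext hwt
    rw [this]
    exact (hpm.div hqm).const_mul c
  have hm0 : (0 : ℝ) < m := by exact_mod_cast hm
  have hDt : 0 < (m : ℝ) ^ ε * t ^ (1 + ε) :=
    mul_pos (Real.rpow_pos_of_pos hm0 _) (Real.rpow_pos_of_pos ht _)
  have hDu : 0 < (m : ℝ) ^ ε * u ^ (1 + ε) :=
    mul_pos (Real.rpow_pos_of_pos hm0 _) (Real.rpow_pos_of_pos hu _)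
  -- the printed block estimate as a measurable function of the block; independence across blocks
  have hg : Measurable fun (v : Fin m → X) =>
      (∑ j : Fin m, wt (v j) * O (v j)) / (∑ j : Fin m, wt (v j)) :=
    (Finset.measurable_sum _ fun (j : Fin m) _ =>
      (hwtm.comp (measurable_pi_apply j)).mul (hOm.comp (measurable_pi_apply j))).div
      (Finset.measurable_sum _ fun (j : Fin m) _ => hwtm.comp (measurable_pi_apply j))
  have hYind : iIndepFun (fun (r : Fin R) ω =>
      (∑ j : Fin m, wt (y ⟨(r : ℕ) * m + j, mul_add_lt hRm r j⟩ ω)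
            * O (y ⟨(r : ℕ) * m + j, mul_add_lt hRm r j⟩ ω))
        / (∑ j : Fin m, wt (y ⟨(r : ℕ) * m + j, mul_add_lt hRm r j⟩ ω))) P :=
    iIndepFun_blockFun hym hind hRm hg
  have hYm : ∀ r : Fin R, Measurable fun ω =>
      (∑ j : Fin m, wt (y ⟨(r : ℕ) * m + j, mul_add_lt hRm r j⟩ ω)
            * O (y ⟨(r : ℕ) * m + j, mul_add_lt hRm r j⟩ ω))
        / (∑ j : Fin m, wt (y ⟨(r : ℕ) * m + j, mul_add_lt hRm r j⟩ ω)) := fun r => by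
    have hblk : Measurable fun ω => fun (i : Fin m) => y ⟨(r : ℕ) * m + i, mul_add_lt hRm r i⟩ ω :=
      measurable_pi_lambda _ fun i => hym _
    exact hg.comp hblk
  -- each block is bad with probability ≤ 1/8 + 1/8
  have hfar : ∀ r ∈ (univ : Finset (Fin R)), P.real {ω | (t + 2 * B * u) / (1 - u) ≤
      |(∑ j : Fin m, wt (y ⟨(r : ℕ) * m + j, mul_add_lt hRm r j⟩ ω)
            * O (y ⟨(r : ℕ) * m + j, mul_add_lt hRm r j⟩ ω))
          / (∑ j : Fin m, wt (y ⟨(r : ℕ) * m + j, mul_add_lt hRm r j⟩ ω))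
        - ∫ z, p z * O z ∂μ|} ≤ 1 / 4 := by
    intro r _
    have hE := shiftedEstimate_heavyTail_iid
      (x := fun (i : Fin m) => y ⟨(r : ℕ) * m + i, mul_add_lt hRm r i⟩) (fun i => hym _)
      (iIndepFun_block hind hRm r) hp0 hpm hpi hp1 hq0 hqm hε0 hε1 hA1i hOm hOB hOi
      (fun i => hlaw _) hm ht
    have hW := meanWeight_heavyTail_iid
      (x := fun (i : Fin m) => y ⟨(r : ℕ) * m + i, mul_add_lt hRm r i⟩) (fun i => hym _)
      (iIndepFun_block hind hRm r) hp0 hpm hpi hp1 hq0 hqm hε0 hε1 hA1i (fun i => hlaw _) hm hu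
    have hratio : ∀ ω,
        (∑ j : Fin m, wt (y ⟨(r : ℕ) * m + j, mul_add_lt hRm r j⟩ ω)
              * O (y ⟨(r : ℕ) * m + j, mul_add_lt hRm r j⟩ ω))
          / (∑ j : Fin m, wt (y ⟨(r : ℕ) * m + j, mul_add_lt hRm r j⟩ ω))
        = ((∑ j : Fin m, p (y ⟨(r : ℕ) * m + j, mul_add_lt hRm r j⟩ ω)
              / q (y ⟨(r : ℕ) * m + j, mul_add_lt hRm r j⟩ ω)
              * O (y ⟨(r : ℕ) * m + j, mul_add_lt hRm r j⟩ ω)) / m)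
          / ((∑ j : Fin m, p (y ⟨(r : ℕ) * m + j, mul_add_lt hRm r j⟩ ω)
              / q (y ⟨(r : ℕ) * m + j, mul_add_lt hRm r j⟩ ω)) / m) := fun ω => by
      rw [blockSelfNorm_scale_free hc hwt fun i => y ⟨(r : ℕ) * m + i, mul_add_lt hRm r i⟩ ω,
        blockSelfNorm_eq_div hm]
    have hsub : {ω | (t + 2 * B * u) / (1 - u) ≤
          |(∑ j : Fin m, wt (y ⟨(r : ℕ) * m + j, mul_add_lt hRm r j⟩ ω)
                * O (y ⟨(r : ℕ) * m + j, mul_add_lt hRm r j⟩ ω))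
              / (∑ j : Fin m, wt (y ⟨(r : ℕ) * m + j, mul_add_lt hRm r j⟩ ω))
            - ∫ z, p z * O z ∂μ|}
        ⊆ {ω | t ≤ |(∑ j : Fin m, p (y ⟨(r : ℕ) * m + j, mul_add_lt hRm r j⟩ ω)
              / q (y ⟨(r : ℕ) * m + j, mul_add_lt hRm r j⟩ ω)
              * (O (y ⟨(r : ℕ) * m + j, mul_add_lt hRm r j⟩ ω) + B)) / m
              - (∫ z, p z * O z ∂μ + B)|}
          ∪ {ω | u ≤ |(∑ j : Fin m, p (y ⟨(r : ℕ) * m + j, mul_add_lt hRm r j⟩ ω)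
              / q (y ⟨(r : ℕ) * m + j, mul_add_lt hRm r j⟩ ω)) / m - 1|} := by
      intro ω hω
      simp only [Set.mem_setOf_eq, Set.mem_union] at hω ⊢
      rw [hratio ω] at hω
      by_contra hcon
      simp only [not_or, not_le] at hcon
      obtain ⟨h1, h2⟩ := hcon
      set A := (∑ j : Fin m, p (y ⟨(r : ℕ) * m + j, mul_add_lt hRm r j⟩ ω)
          / q (y ⟨(r : ℕ) * m + j, mul_add_lt hRm r j⟩ ω)
          * O (y ⟨(r : ℕ) * m + j, mul_add_lt hRm r j⟩ ω)) / m with hA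
      set W := (∑ j : Fin m, p (y ⟨(r : ℕ) * m + j, mul_add_lt hRm r j⟩ ω)
          / q (y ⟨(r : ℕ) * m + j, mul_add_lt hRm r j⟩ ω)) / m with hW'
      set a := ∫ z, p z * O z ∂μ with ha'
      -- the shifted block estimate is `A + B·W`
      have hshift : (∑ j : Fin m, p (y ⟨(r : ℕ) * m + j, mul_add_lt hRm r j⟩ ω)
            / q (y ⟨(r : ℕ) * m + j, mul_add_lt hRm r j⟩ ω)
            * (O (y ⟨(r : ℕ) * m + j, mul_add_lt hRm r j⟩ ω) + B)) / m = A + B * W := by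
        rw [hA, hW', mul_comm B, div_mul_eq_mul_div, ← add_div, Finset.sum_mul,
          ← Finset.sum_add_distrib]
        congr 1
        exact Finset.sum_congr rfl fun j _ => by ring
      rw [hshift] at h1
      have hWlo : 1 - u ≤ W := by
        have := (abs_lt.1 h2).1
        linarith
      have hW0 : 0 < W := by linarith
      have key : |A / W - a| ≤ (|(A + B * W) - (a + B)| + |a + B| * |W - 1|) / (1 - u) := by
        have h := abs_div_sub_div_le (A := A + B * W) (B := W) (a := a + B) (b := 1)
          (β := 1 - u) (by linarith) hWlo one_ne_zero
        have e1 : (A + B * W) / W = A / W + B := by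
          field_simp
        rw [e1, div_one, show A / W + B - (a + B) = A / W - a by ring] at h
        exact h
      have haB : |a + B| ≤ 2 * B := by
        calc |a + B| ≤ |a| + |B| := abs_add_le _ _
          _ ≤ B + B := add_le_add ha (le_of_eq (abs_of_nonneg hB0))
          _ = 2 * B := by ring
      have hnum' : |(A + B * W) - (a + B)| + |a + B| * |W - 1| < t + 2 * B * u := by
        have h3 : |a + B| * |W - 1| ≤ 2 * B * u :=
          mul_le_mul haB h2.le (abs_nonneg _) (by linarith)
        linarith
      have hlt : |A / W - a| < (t + 2 * B * u) / (1 - u) :=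
        key.trans_lt (div_lt_div_of_pos_right hnum' (by linarith))
      linarith
    have hE' : 5 * ((2 * B) ^ (1 + ε) * ∫ z, p z ^ (1 + ε) / q z ^ ε ∂μ)
        / ((m : ℝ) ^ ε * t ^ (1 + ε)) ≤ 1 / 8 := by
      rw [div_le_iff₀ hDt]
      linarith
    have hW' : 5 * (∫ z, p z ^ (1 + ε) / q z ^ ε ∂μ) / ((m : ℝ) ^ ε * u ^ (1 + ε)) ≤ 1 / 8 := by
      rw [div_le_iff₀ hDu]
      linarith
    calc P.real _ ≤ P.real _ := measureReal_mono hsub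
      _ ≤ _ := measureReal_union_le _ _
      _ ≤ 1 / 8 + 1 / 8 := add_le_add (hE.trans hE') (hW.trans hW')
      _ = 1 / 4 := by norm_num
  have h := measureReal_half_far_le (μ := P) (univ : Finset (Fin R)) hYind hYm
    (∫ z, p z * O z ∂μ) ((t + 2 * B * u) / (1 - u)) hfar
  simpa only [card_univ, Fintype.card_fin] using h

/-- **THE PRINTED SELF-NORMALISED ESTIMATE WITH NO SECOND WEIGHT MOMENT, FOR ANY SAMPLE MEDIAN**
`med(ω)` of the `R` printed block estimates: under the same hypotheses,
`P((t + 2Bu)/(1 − u) ≤ |med − ∫ p·O dμ|) ≤ exp(−R/8)`. [ours] -/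
theorem selfNormReweighting_sampleMedian_confidence_heavyTail {y : Fin n → Ω → X}
    (hym : ∀ j, Measurable (y j)) (hind : iIndepFun y P) (hp0 : ∀ z, 0 ≤ p z)
    (hpm : Measurable p) (hpi : Integrable p μ) (hp1 : ∫ z, p z ∂μ = 1) (hq0 : ∀ z, 0 < q z)
    (hqm : Measurable q) (hε0 : 0 < ε) (hε1 : ε ≤ 1)
    (hA1i : Integrable (fun z => p z ^ (1 + ε) / q z ^ ε) μ) (hOm : Measurable O) {B : ℝ}
    (hOB : ∀ z, |O z| ≤ B)
    (hlaw : ∀ j, Measure.map (y j) P = μ.withDensity fun z => ENNReal.ofReal (q z))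
    {wt : X → ℝ} {c : ℝ} (hc : 0 < c) (hwt : ∀ z, wt z = c * (p z / q z))
    (hm : 1 ≤ m) (hRm : R * m ≤ n) {t u : ℝ} (ht : 0 < t) (hu : 0 < u) (hu1 : u < 1)
    (hvt : 40 * ((2 * B) ^ (1 + ε) * ∫ z, p z ^ (1 + ε) / q z ^ ε ∂μ)
      ≤ (m : ℝ) ^ ε * t ^ (1 + ε))
    (hvu : 40 * ∫ z, p z ^ (1 + ε) / q z ^ ε ∂μ ≤ (m : ℝ) ^ ε * u ^ (1 + ε)) {med : Ω → ℝ}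
    (hlo : ∀ ω, (R : ℝ) / 2 ≤ #{r ∈ (univ : Finset (Fin R)) | med ω ≤
        (∑ j : Fin m, wt (y ⟨((r : Fin R) : ℕ) * m + j, mul_add_lt hRm r j⟩ ω)
              * O (y ⟨((r : Fin R) : ℕ) * m + j, mul_add_lt hRm r j⟩ ω))
            / (∑ j : Fin m, wt (y ⟨((r : Fin R) : ℕ) * m + j, mul_add_lt hRm r j⟩ ω))})
    (hhi : ∀ ω, (R : ℝ) / 2 ≤ #{r ∈ (univ : Finset (Fin R)) |
        (∑ j : Fin m, wt (y ⟨((r : Fin R) : ℕ) * m + j, mul_add_lt hRm r j⟩ ω)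
              * O (y ⟨((r : Fin R) : ℕ) * m + j, mul_add_lt hRm r j⟩ ω))
            / (∑ j : Fin m, wt (y ⟨((r : Fin R) : ℕ) * m + j, mul_add_lt hRm r j⟩ ω))
          ≤ med ω}) :
    P.real {ω | (t + 2 * B * u) / (1 - u) ≤ |med ω - ∫ z, p z * O z ∂μ|}
      ≤ exp (-(R / 8)) := by
  refine (measureReal_mono ?_).trans
    (selfNormReweighting_medianOfBlocks_confidence_heavyTail hym hind hp0 hpm hpi hp1 hq0 hqm hε0
      hε1 hA1i hOm hOB hlaw hc hwt hm hRm ht hu hu1 hvt hvu)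
  intro ω hω
  simp only [Set.mem_setOf_eq] at hω ⊢
  by_contra hlt
  push Not at hlt
  have hR : (#(univ : Finset (Fin R)) : ℝ) = R := by rw [card_univ, Fintype.card_fin]
  have h := abs_median_sub_lt_of_card_lt (univ : Finset (Fin R)) _ (hR ▸ hlo ω) (hR ▸ hhi ω)
    (hR ▸ hlt)
  linarith

end Certificate

end Summit.Ventures.LatticeQCDFlow.Scoring.ReweightingMedian

end
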